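import Mathlib
import Literature.Analysis.FluidPDE.GaussianVortexPlanar
import Literature.Analysis.FluidPDE.GaussianVortexPlanarProofs
import Literature.Analysis.FunctionSpaces.BMOCarlesonProofs
import Summits.AnomalousDissipation.AnomalousDissipation.Theorems.MarginalStabilityChainStretchedVortexRowsStubCoreInverseTools
import Summits.AnomalousDissipation.AnomalousDissipation.Theorems.MarginalStabilityChainStretchedVortexRowsStubCoreInverseAngular
import Summits.AnomalousDissipation.AnomalousDissipation.Theorems.MarginalStabilityChainStretchedVortexRowsStubCoreInverseBurgersPhi
import HarnessLib

/-!
# Helper `coreRotation_local_skew` toward stub `stub_coreInverse` of the line `braid-closed-large-circulation-gluing`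
# (crux stmt-AnomalousDissipation-3009, `MarginalStabilityChain.StretchedVortexRows`)

The LOCAL part `v^G·∇` of the rotation term `Λ_G` is skew-symmetric in `L²(G⁻¹)`: for `w = G u` with `u ∈ C¹`,
`u, Du` bounded,

  `⟨v^G·∇w, w⟩_{L²(G⁻¹)} = ∫ G⁻¹ w ⟪v^G, ∇w⟫ = 0`      (`coreRotation_local_skew`).

Proof: `⟪v^G(ξ), ∇w(ξ)⟫ = Ω(ξ) Dw(ξ)[ξ^⊥]` with `Ω = (8π)⁻¹φ(|ξ|²/4)` (landed: `inner_gaussVortexVelocity_gradient_eq_mul_angularDeriv`)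
and `D(Gu)[ξ^⊥] = G Du[ξ^⊥]` (`G` is radial), so the integrand is `ρ u Du[ξ^⊥] = ½ D(ρ u²)[ξ^⊥]` with the RADIAL weight
`ρ = Ω G` (`Dρ[ξ^⊥] = 0`, landed `fderiv_perp_eq_zero_of_radial`); and the angular derivative of a `C¹` function with one
moment integrates to zero (landed `integral_fderiv_perp_eq_zero`). The moments come from `0 < ρ ≤ G/(8π)`,
`‖Dρ‖ ≤ (3/(32π)) |ξ| G` (`|φ′| ≤ ½`, landed `abs_deriv_burgersPhi_le_half`; `∇G = −(ξ/2)G`) and the Gaussian moments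
`∫ (1+|ξ|)^N G < ∞` (`integrable_one_add_norm_pow_mul_gaussVortexProfile`, from the tree's heat-kernel bounds).

References: Th. Gallay, C. E. Wayne, Comm. Math. Phys. 255 (2005), Lemma 4.8 (skew-symmetry of `Λ`); T. Li, D. Wei, Z. Zhang,
arXiv:1701.06269, Lemma 2.1(2).
-/

set_option linter.dupNamespace false

noncomputable section

open scoped RealInnerProductSpace Topology
open MeasureTheory WithLp Function Filter

namespace Summit.AnomalousDissipation.AnomalousDissipation.Theorems.MarginalStabilityChainStretchedVortexRows

open Literature.Analysis.FluidPDE Literature.Analysis.UnboundedOperators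

/-! ### Gaussian moments -/

/-- `G = 16π Γ₂²`: the Gaussian vortex profile is `16π` times the square of the heat kernel of `ℝ²` at time `2`. [folklore] -/
theorem gaussVortexProfile_eq_mul_heatKernel_two_sq (z : EuclideanSpace ℝ (Fin 2)) :
    gaussVortexProfile z = 16 * Real.pi * heatKernel (E := EuclideanSpace ℝ (Fin 2)) 2 z ^ 2 := by
  rw [gaussVortexProfile, heatKernel_eq, finrank_euclideanSpace_fin]
  have h1 : ((4 : ℝ) * Real.pi * 2) ^ (-((2 : ℕ) : ℝ) / 2) = (8 * Real.pi)⁻¹ := by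
    rw [show (-((2 : ℕ) : ℝ) / 2) = -1 by norm_num, Real.rpow_neg_one]; ring
  rw [h1, mul_pow, ← Real.exp_nat_mul]
  have h2 : ((2 : ℕ) : ℝ) * (-(1 / (4 * 2)) * ‖z‖ ^ 2) = -(‖z‖ ^ 2 / 4) := by push_cast; ring
  rw [h2]
  field_simp
  norm_num

/-- **Polynomial moments of the Gaussian**: `(1 + |z|)^N G(z)` is integrable for every `N`. [folklore] -/
theorem integrable_one_add_norm_pow_mul_gaussVortexProfile (N : ℕ) :
    Integrable fun z : EuclideanSpace ℝ (Fin 2) => (1 + ‖z‖) ^ N * gaussVortexProfile z := by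
  obtain ⟨C, hC⟩ := Literature.Analysis.FunctionSpaces.BMOInv.exists_bound_one_add_norm_pow_mul_heatKernel
    (E := EuclideanSpace ℝ (Fin 2)) (t := 2) two_pos 0 N
  have hK : ∀ z : EuclideanSpace ℝ (Fin 2),
      Literature.Analysis.FunctionSpaces.BMOInv.heatKernel (E := EuclideanSpace ℝ (Fin 2)) 2 (0 - z) = heatKernel 2 z := by
    intro z
    change heatKernel (E := EuclideanSpace ℝ (Fin 2)) 2 (0 - z) = heatKernel 2 z
    rw [heatKernel_eq, heatKernel_eq, zero_sub, norm_neg]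
  have hint : Integrable fun z : EuclideanSpace ℝ (Fin 2) => (16 * Real.pi * C) * heatKernel 2 z :=
    (integrable_heatKernel_holds two_pos).const_mul _
  refine hint.mono' ?_ (Eventually.of_forall fun z => ?_)
  · exact (((continuous_const.add continuous_norm).pow N).mul
      (contDiff_gaussVortexProfile (n := 0)).continuous).aestronglyMeasurable
  have hKpos : 0 < heatKernel (E := EuclideanSpace ℝ (Fin 2)) 2 z := heatKernel_pos two_pos z
  have hb := hC z
  rw [hK] at hb
  rw [Real.norm_of_nonneg (mul_nonneg (by positivity) (gaussVortexProfile_pos z).le),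
    gaussVortexProfile_eq_mul_heatKernel_two_sq]
  calc (1 + ‖z‖) ^ N * (16 * Real.pi * heatKernel 2 z ^ 2)
      = 16 * Real.pi * ((1 + ‖z‖) ^ N * heatKernel 2 z) * heatKernel 2 z := by ring
    _ ≤ 16 * Real.pi * C * heatKernel 2 z := by gcongr

/-- Integrability against the Gaussian class: a continuous `F` with `‖F(z)‖ ≤ A (1 + |z|)^N G(z)` is integrable. [folklore] -/
theorem integrable_of_le_one_add_norm_pow_mul_gauss {F : EuclideanSpace ℝ (Fin 2) → ℝ} (hF : Continuous F)
    {A : ℝ} {N : ℕ} (hle : ∀ z, ‖F z‖ ≤ A * ((1 + ‖z‖) ^ N * gaussVortexProfile z)) : Integrable F :=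
  ((integrable_one_add_norm_pow_mul_gaussVortexProfile N).const_mul A).mono' hF.aestronglyMeasurable
    (Eventually.of_forall hle)

/-! ### The radial weight `ρ = Ω G` -/

/-- `‖DG(ξ)‖ ≤ (G(ξ)/2) |ξ|` (from `DG(ξ)[v] = −(G(ξ)/2)⟪ξ, v⟫`). [folklore] -/
theorem norm_fderiv_gaussVortexProfile_le (ξ : EuclideanSpace ℝ (Fin 2)) :
    ‖fderiv ℝ gaussVortexProfile ξ‖ ≤ gaussVortexProfile ξ / 2 * ‖ξ‖ := by
  refine ContinuousLinearMap.opNorm_le_bound _ (by positivity [gaussVortexProfile_pos ξ]) fun v => ?_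
  rw [fderiv_gaussVortexProfile_apply, Real.norm_eq_abs, abs_mul, abs_neg,
    abs_of_pos (by positivity [gaussVortexProfile_pos ξ])]
  rw [mul_assoc]
  exact mul_le_mul_of_nonneg_left (abs_real_inner_le_norm ξ v) (by positivity [gaussVortexProfile_pos ξ])

/-- The derivative of the weight `ρ(ξ) = (8π)⁻¹ φ(|ξ|²/4) G(ξ) = Ω(ξ) G(ξ)`:
`Dρ(ξ) = G(ξ)·((8π)⁻¹ φ′(q)·½⟪ξ,·⟫) + (8π)⁻¹φ(q)·DG(ξ)`, `q = |ξ|²/4`. [folklore] -/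
theorem hasFDerivAt_omegaG (ξ : EuclideanSpace ℝ (Fin 2)) :
    HasFDerivAt (fun η : EuclideanSpace ℝ (Fin 2) => (8 * Real.pi)⁻¹ * burgersPhi (‖η‖ ^ 2 / 4) * gaussVortexProfile η)
      (((8 * Real.pi)⁻¹ * burgersPhi (‖ξ‖ ^ 2 / 4)) • fderiv ℝ gaussVortexProfile ξ +
        gaussVortexProfile ξ • ((8 * Real.pi)⁻¹ • (deriv burgersPhi (‖ξ‖ ^ 2 / 4) • ((1 / 2 : ℝ) • innerSL ℝ ξ)))) ξ := by
  have hq : HasFDerivAt (fun η : EuclideanSpace ℝ (Fin 2) => ‖η‖ ^ 2 / 4) ((1 / 2 : ℝ) • innerSL ℝ ξ) ξ := by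
    have h := (hasStrictFDerivAt_norm_sq ξ).hasFDerivAt.const_mul (1 / 4 : ℝ)
    have hfun : (fun η : EuclideanSpace ℝ (Fin 2) => ‖η‖ ^ 2 / 4) = fun η => (1 / 4 : ℝ) * ‖η‖ ^ 2 := by
      funext η; ring
    rw [hfun]
    refine h.congr_fderiv ?_
    ext v
    simp [two_smul]
    ring
  have hφd : HasDerivAt burgersPhi (deriv burgersPhi (‖ξ‖ ^ 2 / 4)) (‖ξ‖ ^ 2 / 4) :=
    ((contDiff_burgersPhi (n := 1)).differentiable one_ne_zero _).hasDerivAt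
  have hφ : HasFDerivAt (fun η : EuclideanSpace ℝ (Fin 2) => burgersPhi (‖η‖ ^ 2 / 4))
      (deriv burgersPhi (‖ξ‖ ^ 2 / 4) • ((1 / 2 : ℝ) • innerSL ℝ ξ)) ξ :=
    hφd.comp_hasFDerivAt ξ hq
  have hG : HasFDerivAt gaussVortexProfile (fderiv ℝ gaussVortexProfile ξ) ξ :=
    ((contDiff_gaussVortexProfile (n := 1)).differentiable one_ne_zero ξ).hasFDerivAt
  exact (hφ.const_mul ((8 * Real.pi)⁻¹)).mul hG

/-- `‖Dρ(ξ)‖ ≤ (3/(32π)) |ξ| G(ξ)` for `ρ = Ω G` (`0 ≤ φ ≤ 1`, `|φ′| ≤ ½`, `‖DG‖ ≤ (G/2)|ξ|`). [folklore] -/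
theorem norm_fderiv_omegaG_le (ξ : EuclideanSpace ℝ (Fin 2)) :
    ‖fderiv ℝ (fun η : EuclideanSpace ℝ (Fin 2) => (8 * Real.pi)⁻¹ * burgersPhi (‖η‖ ^ 2 / 4) * gaussVortexProfile η) ξ‖ ≤
      3 / (32 * Real.pi) * ‖ξ‖ * gaussVortexProfile ξ := by
  rw [(hasFDerivAt_omegaG ξ).fderiv]
  have hGpos := gaussVortexProfile_pos ξ
  have hq0 : 0 ≤ ‖ξ‖ ^ 2 / 4 := by positivity
  have hφ0 : 0 ≤ burgersPhi (‖ξ‖ ^ 2 / 4) := (burgersPhi_pos _).le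
  have hφ1 : burgersPhi (‖ξ‖ ^ 2 / 4) ≤ 1 := burgersPhi_le_one hq0
  have hφ' : |deriv burgersPhi (‖ξ‖ ^ 2 / 4)| ≤ 1 / 2 := abs_deriv_burgersPhi_le_half _ hq0
  have hc0 : 0 ≤ (8 * Real.pi)⁻¹ := by positivity
  have h1 : ‖((8 * Real.pi)⁻¹ * burgersPhi (‖ξ‖ ^ 2 / 4)) • fderiv ℝ gaussVortexProfile ξ‖ ≤
      (8 * Real.pi)⁻¹ * (gaussVortexProfile ξ / 2 * ‖ξ‖) := by
    rw [norm_smul, Real.norm_eq_abs, abs_of_nonneg (mul_nonneg hc0 hφ0)]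
    calc (8 * Real.pi)⁻¹ * burgersPhi (‖ξ‖ ^ 2 / 4) * ‖fderiv ℝ gaussVortexProfile ξ‖
        ≤ (8 * Real.pi)⁻¹ * 1 * (gaussVortexProfile ξ / 2 * ‖ξ‖) := by
          gcongr
          exact norm_fderiv_gaussVortexProfile_le ξ
      _ = (8 * Real.pi)⁻¹ * (gaussVortexProfile ξ / 2 * ‖ξ‖) := by ring
  have h2 : ‖gaussVortexProfile ξ • ((8 * Real.pi)⁻¹ • (deriv burgersPhi (‖ξ‖ ^ 2 / 4) • ((1 / 2 : ℝ) • innerSL ℝ ξ)))‖ ≤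
      gaussVortexProfile ξ * ((8 * Real.pi)⁻¹ * (1 / 2 * (1 / 2 * ‖ξ‖))) := by
    rw [norm_smul, norm_smul, norm_smul, norm_smul, Real.norm_eq_abs, abs_of_pos hGpos, Real.norm_eq_abs,
      abs_of_nonneg hc0, Real.norm_eq_abs, Real.norm_eq_abs, abs_of_pos (by norm_num : (0:ℝ) < 1 / 2),
      innerSL_apply_norm]
    gcongr
  calc _ ≤ ‖((8 * Real.pi)⁻¹ * burgersPhi (‖ξ‖ ^ 2 / 4)) • fderiv ℝ gaussVortexProfile ξ‖ +
        ‖gaussVortexProfile ξ • ((8 * Real.pi)⁻¹ • (deriv burgersPhi (‖ξ‖ ^ 2 / 4) • ((1 / 2 : ℝ) • innerSL ℝ ξ)))‖ :=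
        norm_add_le _ _
    _ ≤ (8 * Real.pi)⁻¹ * (gaussVortexProfile ξ / 2 * ‖ξ‖) + gaussVortexProfile ξ * ((8 * Real.pi)⁻¹ * (1 / 2 * (1 / 2 * ‖ξ‖))) :=
        add_le_add h1 h2
    _ = 3 / (32 * Real.pi) * ‖ξ‖ * gaussVortexProfile ξ := by
        field_simp
        ring

/-! ### The skew-symmetry of the local rotation term -/

/-- **`⟨v^G·∇w, w⟩_{L²(G⁻¹)} = 0`** for `w = G u`, `u ∈ C¹` with `u, Du` bounded: the local rotation term of `Λ_G` is
skew-symmetric in `L²(G⁻¹)` (`v^G·∇w = Ω ∂_θw`, `Ω G` radial, and `∫ ∂_θ(ΩG u²) = 0`). [folklore] -/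
theorem coreRotation_local_skew :
    ∀ u : EuclideanSpace ℝ (Fin 2) → ℝ, ContDiff ℝ 1 u →
      (∃ M : ℝ, ∀ ξ, |u ξ| ≤ M ∧ ‖fderiv ℝ u ξ‖ ≤ M) →
      ∫ ξ, (gaussVortexProfile ξ)⁻¹ * (gaussVortexProfile ξ * u ξ) *
          ⟪gaussVortexVelocity ξ, gradient (fun η => gaussVortexProfile η * u η) ξ⟫ = 0 := by
  intro u hu hM
  obtain ⟨M, hM⟩ := hM
  have hM0 : 0 ≤ M := (abs_nonneg (u 0)).trans (hM 0).1
  -- the radial weight `ρ = Ω G` and the potential `h = ρ u²`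
  set ρ : EuclideanSpace ℝ (Fin 2) → ℝ :=
    fun η => (8 * Real.pi)⁻¹ * burgersPhi (‖η‖ ^ 2 / 4) * gaussVortexProfile η with hρdef
  set h : EuclideanSpace ℝ (Fin 2) → ℝ := fun η => ρ η * u η ^ 2 with hhdef
  have hρC : ContDiff ℝ 1 ρ :=
    (contDiff_const.mul (contDiff_burgersPhi.comp ((contDiff_norm_sq ℝ).div_const 4))).mul contDiff_gaussVortexProfile
  have hhC : ContDiff ℝ 1 h := hρC.mul (hu.pow 2)
  have hρrad : ∀ ξ η : EuclideanSpace ℝ (Fin 2), ‖ξ‖ = ‖η‖ → ρ ξ = ρ η := by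
    intro ξ η hn
    simp only [hρdef, gaussVortexProfile, hn]
  have hρpos : ∀ ξ, 0 < ρ ξ := fun ξ => by
    simp only [hρdef]
    exact mul_pos (mul_pos (by positivity) (burgersPhi_pos _)) (gaussVortexProfile_pos ξ)
  have hρle : ∀ ξ, ρ ξ ≤ (8 * Real.pi)⁻¹ * gaussVortexProfile ξ := by
    intro ξ
    simp only [hρdef]
    have hφ1 : burgersPhi (‖ξ‖ ^ 2 / 4) ≤ 1 := burgersPhi_le_one (by positivity)
    have := gaussVortexProfile_pos ξ
    calc (8 * Real.pi)⁻¹ * burgersPhi (‖ξ‖ ^ 2 / 4) * gaussVortexProfile ξ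
        ≤ (8 * Real.pi)⁻¹ * 1 * gaussVortexProfile ξ := by gcongr
      _ = (8 * Real.pi)⁻¹ * gaussVortexProfile ξ := by ring
  -- derivatives
  have hGd : ∀ ξ, HasFDerivAt gaussVortexProfile (fderiv ℝ gaussVortexProfile ξ) ξ := fun ξ =>
    ((contDiff_gaussVortexProfile (n := 1)).differentiable one_ne_zero ξ).hasFDerivAt
  have hud : ∀ ξ, HasFDerivAt u (fderiv ℝ u ξ) ξ := fun ξ => (hu.differentiable one_ne_zero ξ).hasFDerivAt
  have hρd : ∀ ξ, HasFDerivAt ρ (fderiv ℝ ρ ξ) ξ := fun ξ => (hρC.differentiable one_ne_zero ξ).hasFDerivAt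
  have hGperp : ∀ ξ, fderiv ℝ gaussVortexProfile ξ (perp ξ) = 0 := fun ξ => by
    rw [fderiv_gaussVortexProfile_apply, inner_self_perp, mul_zero]
  have hGu : ∀ ξ, fderiv ℝ (fun η => gaussVortexProfile η * u η) ξ (perp ξ) = gaussVortexProfile ξ * fderiv ℝ u ξ (perp ξ) := by
    intro ξ
    rw [((hGd ξ).fun_mul (hud ξ)).fderiv]
    simp only [FunLike.coe_add, Pi.add_apply, FunLike.coe_smul, Pi.smul_apply, smul_eq_mul,
      hGperp, mul_zero, add_zero]
  have hh' : ∀ ξ, fderiv ℝ h ξ (perp ξ) = 2 * (ρ ξ * u ξ * fderiv ℝ u ξ (perp ξ)) := by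
    intro ξ
    have hsq : HasFDerivAt (fun η => u η ^ 2) ((2 * u ξ) • fderiv ℝ u ξ) ξ := by simpa using (hud ξ).pow 2
    rw [hhdef, ((hρd ξ).fun_mul hsq).fderiv]
    simp only [FunLike.coe_add, Pi.add_apply, FunLike.coe_smul, Pi.smul_apply, smul_eq_mul,
      fderiv_perp_eq_zero_of_radial hρrad ξ, mul_zero, add_zero]
    ring
  -- the integrand is `½ ∂_θ h`
  have hpt : ∀ ξ, (gaussVortexProfile ξ)⁻¹ * (gaussVortexProfile ξ * u ξ) *
      ⟪gaussVortexVelocity ξ, gradient (fun η => gaussVortexProfile η * u η) ξ⟫ = 1 / 2 * fderiv ℝ h ξ (perp ξ) := by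
    intro ξ
    rw [inner_gaussVortexVelocity_gradient_eq_mul_angularDeriv, hGu, hh']
    have hG0 : gaussVortexProfile ξ ≠ 0 := (gaussVortexProfile_pos ξ).ne'
    simp only [hρdef]
    field_simp
  simp_rw [hpt, integral_const_mul]
  -- moments of `h`
  have hint0 : Integrable fun x => ‖x‖ * h x := by
    refine integrable_of_le_one_add_norm_pow_mul_gauss (continuous_norm.mul hhC.continuous)
      (A := (8 * Real.pi)⁻¹ * M ^ 2) (N := 1) fun z => ?_
    simp only [pow_one]
    rw [Real.norm_eq_abs, abs_mul, abs_norm, hhdef]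
    simp only
    rw [abs_mul, abs_of_pos (hρpos z), abs_pow]
    have hu2 : |u z| ^ 2 ≤ M ^ 2 := pow_le_pow_left₀ (abs_nonneg _) (hM z).1 2
    have hz : ‖z‖ ≤ 1 + ‖z‖ := by linarith [norm_nonneg z]
    have hGpos := gaussVortexProfile_pos z
    have hprod : ρ z * |u z| ^ 2 ≤ ((8 * Real.pi)⁻¹ * gaussVortexProfile z) * M ^ 2 :=
      mul_le_mul (hρle z) hu2 (sq_nonneg _) (by positivity)
    calc ‖z‖ * (ρ z * |u z| ^ 2) ≤ (1 + ‖z‖) * (((8 * Real.pi)⁻¹ * gaussVortexProfile z) * M ^ 2) :=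
          mul_le_mul hz hprod (mul_nonneg (hρpos z).le (sq_nonneg _)) (by positivity)
      _ = (8 * Real.pi)⁻¹ * M ^ 2 * ((1 + ‖z‖) * gaussVortexProfile z) := by ring
  have hint1 : Integrable fun x => ‖x‖ * ‖fderiv ℝ h x‖ := by
    refine integrable_of_le_one_add_norm_pow_mul_gauss
      (continuous_norm.mul (hhC.continuous_fderiv one_ne_zero).norm)
      (A := M ^ 2 * (3 / (32 * Real.pi)) + 2 * (8 * Real.pi)⁻¹ * M ^ 2) (N := 2) fun z => ?_
    rw [Real.norm_eq_abs, abs_mul, abs_norm, abs_norm]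
    have hsq : HasFDerivAt (fun η => u η ^ 2) ((2 * u z) • fderiv ℝ u z) z := by simpa using (hud z).pow 2
    rw [hhdef, ((hρd z).fun_mul hsq).fderiv]
    have hGpos := gaussVortexProfile_pos z
    have hz1 : ‖z‖ ≤ (1 + ‖z‖) ^ 2 := by nlinarith [norm_nonneg z]
    have hz2 : ‖z‖ ^ 2 ≤ (1 + ‖z‖) ^ 2 := by nlinarith [norm_nonneg z]
    have hu0 := (hM z).1
    have hu1 := (hM z).2
    have hρ' := norm_fderiv_omegaG_le z
    have hterm1 : ‖ρ z • ((2 * u z) • fderiv ℝ u z)‖ ≤ (8 * Real.pi)⁻¹ * gaussVortexProfile z * (2 * M * M) := by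
      rw [norm_smul, norm_smul, Real.norm_eq_abs, abs_of_pos (hρpos z), Real.norm_eq_abs, abs_mul,
        abs_of_pos (by norm_num : (0:ℝ) < 2)]
      gcongr
      exact hρle z
    have hterm2 : ‖(u z ^ 2) • fderiv ℝ ρ z‖ ≤ M ^ 2 * (3 / (32 * Real.pi) * ‖z‖ * gaussVortexProfile z) := by
      rw [norm_smul, Real.norm_eq_abs, abs_pow]
      gcongr
    calc ‖z‖ * ‖ρ z • ((2 * u z) • fderiv ℝ u z) + (u z ^ 2) • fderiv ℝ ρ z‖
        ≤ ‖z‖ * (‖ρ z • ((2 * u z) • fderiv ℝ u z)‖ + ‖(u z ^ 2) • fderiv ℝ ρ z‖) := by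
          gcongr; exact norm_add_le _ _
      _ ≤ ‖z‖ * ((8 * Real.pi)⁻¹ * gaussVortexProfile z * (2 * M * M) +
            M ^ 2 * (3 / (32 * Real.pi) * ‖z‖ * gaussVortexProfile z)) := by gcongr
      _ = (2 * (8 * Real.pi)⁻¹ * M ^ 2) * (‖z‖ * gaussVortexProfile z) +
            (M ^ 2 * (3 / (32 * Real.pi))) * (‖z‖ ^ 2 * gaussVortexProfile z) := by ring
      _ ≤ (2 * (8 * Real.pi)⁻¹ * M ^ 2) * ((1 + ‖z‖) ^ 2 * gaussVortexProfile z) +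
            (M ^ 2 * (3 / (32 * Real.pi))) * ((1 + ‖z‖) ^ 2 * gaussVortexProfile z) := by gcongr
      _ = (M ^ 2 * (3 / (32 * Real.pi)) + 2 * (8 * Real.pi)⁻¹ * M ^ 2) * ((1 + ‖z‖) ^ 2 * gaussVortexProfile z) := by
          ring
  rw [integral_fderiv_perp_eq_zero h hhC hint0 hint1, mul_zero]

end Summit.AnomalousDissipation.AnomalousDissipation.Theorems.MarginalStabilityChainStretchedVortexRows

end
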